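import Mathlib

/-!
# Stub `stub_transfer` of line `rainbow-monomials-in-excursion-kernels` — Part 3: conformal
# geometry at a flat boundary point, I (crux `CardyBoundaryCoulombGas.BoundaryDefectGaussianR`,
# stmt-CriticalPhenomena-14132)

Local facts about a holomorphic bijection `w : Ω → ℍ` (injective on the open set `Ω`, `w(Ω) = ℍ`,
holomorphic on an open `U ⊇ Ω`) near a boundary point `b ∈ ∂Ω ∩ U`:

* `transfer_not_mem_image` — a boundary value is never an interior value ("two preimages": open
  mapping at the interior preimage + injectivity + continuity at the boundary point);
* `transfer_im_eq_zero_of_frontier` — hence `w` is REAL on `∂Ω ∩ U`;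
* `transfer_subset_of_preconnected` — a preconnected set missing `∂Ω` and meeting `Ω` lies in `Ω`;
* `transfer_halfBall_subset` — at a FLAT boundary point (`∂Ω ∩ B(b,r)` inside the line
  `b + ℝτ₀`) one of the two open half-balls lies in `Ω`;
* first-order sign lemmas along rays (`transfer_im_deriv_mul_nonneg`,
  `transfer_im_deriv_mul_eq_zero`, `transfer_re_deriv_mul_nonneg`).

All [folklore]; Mathlib: `AnalyticAt.eventually_constant_or_nhds_le_map_nhds` (open mapping),
`IsPreconnected.subset_left_of_subset_union`, `HasDerivAt.real_of_complex`,
`HasDerivWithinAt.nonneg_of_monotoneOn`.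
-/

noncomputable section

open Filter Topology Set

namespace Summit.CriticalPhenomena.CardyFormulaZ2.Cruxes.BoundaryDefectGaussianR.RainbowMonomialsInExcursionKernels

/-- **Boundary values are not interior values.** If `f` is analytic at the points of an open set
`Ω`, injective on `Ω`, and continuous within `Ω` at a point `b ∈ closure Ω ∖ Ω`, then `f b ∉ f(Ω)`:
otherwise, by the open mapping theorem at the interior preimage `z₀`, values of `f` at points of
`Ω` near `b` are attained again near `z₀`, contradicting injectivity. [folklore] -/
theorem transfer_not_mem_image {Ω : Set ℂ} {f : ℂ → ℂ} (hΩ : IsOpen Ω)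
    (hf : ∀ z ∈ Ω, AnalyticAt ℂ f z) (hinj : Set.InjOn f Ω) {b : ℂ} (hb : b ∈ closure Ω)
    (hbΩ : b ∉ Ω) (hcont : ContinuousWithinAt f Ω b) : f b ∉ f '' Ω := by
  rintro ⟨z₀, hz₀, hfz⟩
  have hnc : ¬ (∀ᶠ z in 𝓝 z₀, f z = f z₀) := by
    intro h
    obtain ⟨ε, hε, hball⟩ := Metric.mem_nhds_iff.mp (Filter.inter_mem h (hΩ.mem_nhds hz₀))
    have h1 : z₀ + ((ε / 2 : ℝ) : ℂ) ∈ Metric.ball z₀ ε := by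
      rw [Metric.mem_ball, dist_eq_norm, add_sub_cancel_left, Complex.norm_real, Real.norm_eq_abs,
        abs_of_pos (by positivity)]
      linarith
    have h2 := hball h1
    have heq := hinj h2.2 hz₀ h2.1
    have h3 : ((ε / 2 : ℝ) : ℂ) = 0 := by simpa using heq
    have h4 : (ε / 2 : ℝ) = 0 := by exact_mod_cast h3
    linarith
  have hle := (hf z₀ hz₀).eventually_constant_or_nhds_le_map_nhds.resolve_left hnc
  have hd : 0 < dist b z₀ := dist_pos.mpr (fun h ↦ hbΩ (h ▸ hz₀))
  set ρ := dist b z₀ / 2 with hρ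
  have hρ0 : 0 < ρ := by positivity
  have himg : f '' (Metric.ball z₀ ρ ∩ Ω) ∈ 𝓝 (f b) := by
    rw [← hfz]
    exact hle (Filter.image_mem_map
      (Filter.inter_mem (Metric.ball_mem_nhds z₀ hρ0) (hΩ.mem_nhds hz₀)))
  have hpre := hcont.preimage_mem_nhdsWithin himg
  have hball : Metric.ball b ρ ∈ 𝓝[Ω] b := mem_nhdsWithin_of_mem_nhds (Metric.ball_mem_nhds b hρ0)
  have hne : (𝓝[Ω] b).NeBot := mem_closure_iff_nhdsWithin_neBot.mp hb
  obtain ⟨z, ⟨hz1, hz2⟩, hzΩ⟩ :=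
    hne.nonempty_of_mem (Filter.inter_mem (Filter.inter_mem hpre hball) self_mem_nhdsWithin)
  obtain ⟨z₁, ⟨hz₁b, hz₁Ω⟩, hfz₁⟩ := hz1
  have h5 := hinj hz₁Ω hzΩ hfz₁
  subst h5
  rw [Metric.mem_ball] at hz₁b hz2
  have h6 := dist_triangle b z₁ z₀
  rw [dist_comm b z₁] at h6
  linarith

/-- **`w` is real on the boundary.** For a holomorphic `w` on an open `U ⊇ Ω` mapping the open set
`Ω` bijectively onto `ℍ`, every point `z ∈ ∂Ω ∩ U` has `Im w(z) = 0`: `Im w(z) ≥ 0` by continuity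
and `w(z) ∉ ℍ = w(Ω)` by `transfer_not_mem_image`. [folklore] -/
theorem transfer_im_eq_zero_of_frontier {Ω U : Set ℂ} {w : ℂ → ℂ} (hΩ : IsOpen Ω) (hU : IsOpen U)
    (hΩU : Ω ⊆ U) (hw : DifferentiableOn ℂ w U) (hbij : Set.BijOn w Ω {z : ℂ | 0 < z.im}) {z : ℂ}
    (hz : z ∈ frontier Ω) (hzU : z ∈ U) : (w z).im = 0 := by
  have hcl : z ∈ closure Ω := frontier_subset_closure hz
  have hzΩ : z ∉ Ω := by
    have h := hz.2
    rwa [hΩ.interior_eq] at h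
  have hcont : ContinuousWithinAt w Ω z :=
    ((hw.differentiableAt (hU.mem_nhds hzU)).continuousAt).continuousWithinAt
  have h1 : w z ∉ w '' Ω := transfer_not_mem_image hΩ
    (fun x hx ↦ hw.analyticAt (hU.mem_nhds (hΩU hx))) hbij.injOn hcl hzΩ hcont
  have h2 : w z ∈ closure (w '' Ω) := hcont.mem_closure_image hcl
  rw [hbij.image_eq] at h1 h2
  rw [Complex.closure_setOf_lt_im] at h2
  simp only [Set.mem_setOf_eq, not_lt] at h1 h2
  exact le_antisymm h1 h2

/-- A preconnected set that misses the frontier of an open set `Ω` and meets `Ω` lies in `Ω`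
(`Ω` and the exterior `(closure Ω)ᶜ` separate it). [folklore] -/
theorem transfer_subset_of_preconnected {Ω S : Set ℂ} (hΩ : IsOpen Ω) (hS : IsPreconnected S)
    (hSf : ∀ z ∈ S, z ∉ frontier Ω) (hne : (S ∩ Ω).Nonempty) : S ⊆ Ω := by
  refine hS.subset_left_of_subset_union (v := (closure Ω)ᶜ) hΩ isClosed_closure.isOpen_compl ?_ ?_
    hne
  · exact Set.disjoint_left.mpr fun z hz hz' ↦ hz' (subset_closure hz)
  · intro z hzS
    by_cases hcl : z ∈ closure Ω
    · left
      by_contra hzΩ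
      exact hSf z hzS ⟨hcl, by rwa [hΩ.interior_eq]⟩
    · exact Or.inr hcl

/-- The side functional `z ↦ Re (z/ν)` is real-linear. [folklore] -/
theorem transfer_isLinearMap_side (ν : ℂ) : IsLinearMap ℝ (fun z : ℂ ↦ (z / ν).re) := by
  refine ⟨fun x y ↦ ?_, fun a x ↦ ?_⟩
  · simp only [add_div, Complex.add_re]
  · simp only [Complex.real_smul, mul_div_assoc, Complex.re_ofReal_mul, smul_eq_mul]

/-- **One half-ball lies inside.** Let `Ω` be open, `b ∈ ∂Ω`, and suppose `∂Ω ∩ B(b,r)` lies on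
the line `b + ℝτ₀` (`|τ₀| = 1`). Then one of the two open half-balls of `B(b,r)` cut by that
line — the side of the normal `ν = τ₀ I` or of `ν = −τ₀ I` — is contained in `Ω`: each half-ball
is convex, misses `∂Ω`, and `Ω` meets `B(b,r)` off the line. [folklore] -/
theorem transfer_halfBall_subset {Ω : Set ℂ} (hΩ : IsOpen Ω) {b τ₀ : ℂ} (hτ₀ : ‖τ₀‖ = 1)
    (hb : b ∈ frontier Ω) {r : ℝ} (hr : 0 < r)
    (hflat : ∀ z ∈ frontier Ω, dist z b < r → ((z - b) / τ₀).im = 0) :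
    ∃ ν : ℂ, (ν = τ₀ * Complex.I ∨ ν = -(τ₀ * Complex.I)) ∧
      ∀ z, dist z b < r → 0 < ((z - b) / ν).re → z ∈ Ω := by
  have hτ0 : τ₀ ≠ 0 := fun h ↦ by simp [h] at hτ₀
  have hside₁ : ∀ z, ((z - b) / (τ₀ * Complex.I)).re = ((z - b) / τ₀).im := fun z ↦ by
    rw [← div_div, Complex.div_I, Complex.neg_re, Complex.mul_I_re, neg_neg]
  have hside₂ : ∀ z, ((z - b) / (-(τ₀ * Complex.I))).re = -((z - b) / τ₀).im := fun z ↦ by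
    rw [div_neg, Complex.neg_re, hside₁]
  -- a half ball (for `ν = ±τ₀ I`) that meets `Ω` lies inside `Ω`
  have key : ∀ ν, (ν = τ₀ * Complex.I ∨ ν = -(τ₀ * Complex.I)) →
      (∃ z ∈ Ω, dist z b < r ∧ 0 < ((z - b) / ν).re) →
      ∀ z, dist z b < r → 0 < ((z - b) / ν).re → z ∈ Ω := by
    intro ν hν hex y hyb hys
    obtain ⟨z, hzΩ, hzb, hzs⟩ := hex
    have hpre : IsPreconnected {z | dist z b < r ∧ 0 < ((z - b) / ν).re} := by
      have h1 : {z | dist z b < r ∧ 0 < ((z - b) / ν).re} =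
          Metric.ball b r ∩ {z | (b / ν).re < (z / ν).re} := by
        ext x
        simp only [Set.mem_setOf_eq, Set.mem_inter_iff, Metric.mem_ball, sub_div, Complex.sub_re,
          sub_pos]
      rw [h1]
      exact ((convex_ball b r).inter
        (convex_halfSpace_gt (transfer_isLinearMap_side ν) _)).isPreconnected
    have hmiss : ∀ x ∈ {z | dist z b < r ∧ 0 < ((z - b) / ν).re}, x ∉ frontier Ω := by
      intro x hx hxf
      have h0 := hflat x hxf hx.1
      have h1 := hx.2
      rcases hν with rfl | rfl
      · rw [hside₁, h0] at h1
        exact lt_irrefl _ h1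
      · rw [hside₂, h0, neg_zero] at h1
        exact lt_irrefl _ h1
    exact transfer_subset_of_preconnected hΩ hpre hmiss ⟨z, ⟨hzb, hzs⟩, hzΩ⟩ ⟨hyb, hys⟩
  -- `Ω` meets the ball
  obtain ⟨z, hzΩ, hzb⟩ := Metric.mem_closure_iff.mp (frontier_subset_closure hb) r hr
  rw [dist_comm] at hzb
  rcases lt_trichotomy ((z - b) / τ₀).im 0 with hlt | heq | hgt
  · refine ⟨-(τ₀ * Complex.I), Or.inr rfl, key _ (Or.inr rfl) ⟨z, hzΩ, hzb, ?_⟩⟩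
    rw [hside₂]
    linarith
  · -- the point is on the line: move off it inside `Ω`
    obtain ⟨ε, hε, hεΩ⟩ := Metric.isOpen_iff.mp hΩ z hzΩ
    have hε'0 : 0 < min ε (r - dist z b) := lt_min hε (by linarith)
    have hdzz' : dist (z + ((min ε (r - dist z b) / 2 : ℝ) : ℂ) * (τ₀ * Complex.I)) z =
        min ε (r - dist z b) / 2 := by
      rw [dist_eq_norm, add_sub_cancel_left, norm_mul, norm_mul, Complex.norm_real, Complex.norm_I,
        hτ₀, Real.norm_eq_abs, abs_of_pos (by positivity)]
      ring
    refine ⟨τ₀ * Complex.I, Or.inl rfl, key _ (Or.inl rfl)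
      ⟨z + ((min ε (r - dist z b) / 2 : ℝ) : ℂ) * (τ₀ * Complex.I), ?_, ?_, ?_⟩⟩
    · refine hεΩ ?_
      rw [Metric.mem_ball, hdzz']
      linarith [min_le_left ε (r - dist z b)]
    · calc dist (z + ((min ε (r - dist z b) / 2 : ℝ) : ℂ) * (τ₀ * Complex.I)) b
          ≤ dist (z + ((min ε (r - dist z b) / 2 : ℝ) : ℂ) * (τ₀ * Complex.I)) z + dist z b :=
            dist_triangle _ _ _
        _ < r := by
            rw [hdzz']
            linarith [min_le_right ε (r - dist z b)]
    · rw [hside₁, add_sub_right_comm, add_div, Complex.add_im, heq, zero_add, mul_div_assoc,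
        mul_div_cancel_left₀ _ hτ0, Complex.im_ofReal_mul, Complex.I_im, mul_one]
      positivity
  · refine ⟨τ₀ * Complex.I, Or.inl rfl, key _ (Or.inl rfl) ⟨z, hzΩ, hzb, ?_⟩⟩
    rw [hside₁]
    exact hgt

/-- A real function with a derivative at `0` that does not drop below its value at `0` on a right
neighbourhood has nonnegative derivative. [folklore] -/
theorem transfer_deriv_nonneg_of_right {g : ℝ → ℝ} {g' r : ℝ} (hr : 0 < r) (hg : HasDerivAt g g' 0)
    (hpos : ∀ s, 0 < s → s < r → g 0 ≤ g s) : 0 ≤ g' := by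
  have h1 : Tendsto (slope g 0) (𝓝[Set.Ioi 0] 0) (𝓝 g') :=
    (hasDerivWithinAt_iff_tendsto_slope' (lt_irrefl (0 : ℝ))).mp hg.hasDerivWithinAt
  refine ge_of_tendsto h1 ?_
  filter_upwards [Ioo_mem_nhdsGT hr] with s hs
  rw [slope_def_field, sub_zero]
  exact div_nonneg (sub_nonneg.mpr (hpos s hs.1 hs.2)) hs.1.le

/-- Derivative of `s ↦ Re w(b + sτ)` at `s = 0` along a real ray. [folklore] -/
theorem transfer_hasDerivAt_ray_re {w : ℂ → ℂ} {w' b τ : ℂ} (hw : HasDerivAt w w' b) :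
    HasDerivAt (fun s : ℝ ↦ (w (b + (s : ℂ) * τ)).re) (w' * τ).re 0 := by
  have h1 : HasDerivAt (fun z : ℂ ↦ w (b + z * τ)) (w' * τ) ((0 : ℝ) : ℂ) := by
    rw [Complex.ofReal_zero]
    have hin : HasDerivAt (fun z : ℂ ↦ b + z * τ) τ 0 := by
      simpa using ((hasDerivAt_id (0 : ℂ)).mul_const τ).const_add b
    have hw0 : HasDerivAt w w' (b + 0 * τ) := by simpa using hw
    exact hw0.comp 0 hin
  exact h1.real_of_complex

/-- Derivative of `s ↦ Im w(b + sτ)` at `s = 0` along a real ray. [folklore] -/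
theorem transfer_hasDerivAt_ray_im {w : ℂ → ℂ} {w' b τ : ℂ} (hw : HasDerivAt w w' b) :
    HasDerivAt (fun s : ℝ ↦ (w (b + (s : ℂ) * τ)).im) (w' * τ).im 0 := by
  have h1 : HasDerivAt (fun z ↦ -Complex.I * w z) (-Complex.I * w') b := hw.const_mul _
  have h2 := transfer_hasDerivAt_ray_re (τ := τ) h1
  have h3 : ∀ u : ℂ, (-Complex.I * u).re = u.im := fun u ↦ by
    rw [neg_mul, Complex.neg_re, Complex.I_mul_re, neg_neg]
  simp only [h3, mul_assoc] at h2
  exact h2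

/-- **First-order sign along an inside ray.** If `b + sν ∈ Ω` for small `s > 0`, `Im w > 0` on
`Ω`, `Im w(b) = 0` and `w` has derivative `w′` at `b`, then `Im (w′ν) ≥ 0`. [folklore] -/
theorem transfer_im_deriv_mul_nonneg {Ω : Set ℂ} {w : ℂ → ℂ} {w' b ν : ℂ} {r : ℝ} (hr : 0 < r)
    (hray : ∀ s : ℝ, 0 < s → s < r → b + (s : ℂ) * ν ∈ Ω) (hΩ : ∀ z ∈ Ω, 0 < (w z).im)
    (hb : (w b).im = 0) (hw : HasDerivAt w w' b) : 0 ≤ (w' * ν).im := by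
  refine transfer_deriv_nonneg_of_right hr (transfer_hasDerivAt_ray_im hw) fun s hs hsr ↦ ?_
  simp only [Complex.ofReal_zero, zero_mul, add_zero, hb]
  exact (hΩ _ (hray s hs hsr)).le

/-- **Real boundary values have real tangential derivative.** If `w(b + uτ)` is real for real
`|u| < η` and `w` has derivative `w′` at `b`, then `Im (w′τ) = 0`. [folklore] -/
theorem transfer_im_deriv_mul_eq_zero {w : ℂ → ℂ} {w' b τ : ℂ} {η : ℝ} (hη : 0 < η)
    (hreal : ∀ u : ℝ, |u| < η → (w (b + (u : ℂ) * τ)).im = 0) (hw : HasDerivAt w w' b) :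
    (w' * τ).im = 0 := by
  have h1 := transfer_hasDerivAt_ray_im (τ := τ) hw
  have h2 : HasDerivAt (fun s : ℝ ↦ (w (b + (s : ℂ) * τ)).im) 0 0 := by
    refine (hasDerivAt_const (0 : ℝ) (0 : ℝ)).congr_of_eventuallyEq ?_
    filter_upwards [Metric.ball_mem_nhds (0 : ℝ) hη] with s hs
    rw [Metric.mem_ball, dist_zero_right, Real.norm_eq_abs] at hs
    exact hreal s hs
  exact h1.unique h2

/-- **Increasing real boundary values have nonnegative tangential derivative.** If
`u ↦ Re w(b + uτ)` is strictly increasing for real `|u| < η` and `w` has derivative `w′` at `b`,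
then `Re (w′τ) ≥ 0`. [folklore] -/
theorem transfer_re_deriv_mul_nonneg {w : ℂ → ℂ} {w' b τ : ℂ} {η : ℝ} (hη : 0 < η)
    (hmono : StrictMonoOn (fun u : ℝ ↦ (w (b + (u : ℂ) * τ)).re) (Set.Ioo (-η) η))
    (hw : HasDerivAt w w' b) : 0 ≤ (w' * τ).re := by
  refine transfer_deriv_nonneg_of_right hη (transfer_hasDerivAt_ray_re hw) fun s hs hsη ↦ ?_
  exact (hmono ⟨by linarith, hη⟩ ⟨by linarith, hsη⟩ hs).le

/-- **Registered sub-goal `s6_realBoundaryValues` (Stub 6, geometry I).** A holomorphic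
bijection `w : Ω → ℍ` (holomorphic on an open `U ⊇ Ω`) is real on `∂Ω ∩ U`. [folklore] -/
theorem s6_realBoundaryValues :
    ∀ (Ω U : Set ℂ) (w : ℂ → ℂ), IsOpen Ω → IsOpen U → Ω ⊆ U → DifferentiableOn ℂ w U → Set.BijOn w
    Ω {z : ℂ | 0 < z.im} → ∀ z ∈ frontier Ω, z ∈ U → (w z).im = 0 :=
  fun _ _ _ hΩ hU hΩU hw hbij _ hz hzU ↦ transfer_im_eq_zero_of_frontier hΩ hU hΩU hw hbij hz hzU

end Summit.CriticalPhenomena.CardyFormulaZ2.Cruxes.BoundaryDefectGaussianR.RainbowMonomialsInExcursionKernels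

end
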